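/-
Copyright (c) 2026 the pub-hodgecm-mathlib formalisation cell (harness21).  Prover seat hodgecm-mathlib-LH4-p07 (g4), req620 Track A «(D-RAM) FOUR-FRAME» squad
(heir LEAD F0P3a-plan lineage; dealer LH4-plan lineage WORD #26 (1); MS ROAD A, Stage B₂ brick B7₂ «CORE-HANGING STRATA, TYPE 2», FILE (H1a): the stratum `H(1)`
(`ρ = 0`, axis `(1,1,1)`) — polarisations and classes; Stage B lead LH4-p10 (g2)).  2026-09-04.
-/
import Summits.HodgeConjecture.HodgeConjecture.Theorems.F0P3cDyRamDiagonalCoreHangingPolarisationCountTypeTwo   -- (iii)₂ (b) (this seat): brings (A) `isIntMatrix_smul_inv_fin_three_of_le`, `v_cofactor_le_of_isIntMatrix_smul_inv`, `v_eq_of_fixed_of_bounds`, ★ p856270-chain, ★ Tools, ★ PolarisationCoset, ★ class reps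
import Summits.HodgeConjecture.HodgeConjecture.Theorems.F0P3cDyRamDiagonalGluedRhoZero                          -- ★ p856296 (F0P3-p01 (g31)): `mem_latticeStabilizer_latt_rhoZero_iff` (the stabiliser of `W(y, ζ)`)
import HarnessLib

/-!
# Crux `H413`, MS ROAD A, STAGE B₂ brick B7₂, FILE (H1a): «THE CORE-HANGING STRATUM `H(1)` (`ρ = 0`, axis `(1,1,1)`) — THE TYPE-2 POLARISATIONS AND THEIR `S_F`-CLASSES»

Cell `hodgecm-mathlib` (D-0151), FLOOR 0, crux item H413 = `stmt-HodgeConjecture-24833`; lane `--supports stmt-HodgeConjecture-24833 --as helper` (count-neutral).  THEOREMS ONLY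
(no `def`, no instance, no notation, no `sorry`, default heartbeats).
THE STRATUM (LH4-p10 (g2) skeleton₂ `stub_B7_H` at `ρ = 0`; ★ p856409 `letters_of_hasAxis_H`: `b = 0`, `c = 1`, `|z| = 1`, `|xz − y| = 1`): the lattices `latt W(y, ζ)`,
`W(y, ζ) = (1 0 0; 0 1 0; y ζ ϖ)` with `y, ζ` UNITS — the `s = 0` end of F0P3-p01 (g31)'s ★ p856296 root-glued family `(1 0 0; 0 1 0; y ζ ϖ^{1+s})`.  Here the mechanism differs
from `ρ ≥ 1` (F0P3-p01 (g31) 2026-09-04T00:59:20Z; LH4-p10 (g2) 01:03:42Z q = 4 data point `n₂(H(1)) = 2`; REF5 R5-78 (C), LH4-r01 (g3) DV): (R) is VACUOUS, every type-2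
polarisation `D` has all three `|Dᵢ| = 1`, and the one binding condition is the `(2,2)` cofactor `(D₀ + Ny·D₂)(D₁ + Nζ·D₂) ≡ Ny·Nζ·D₂² (𝔭)`; the stabiliser is
`S_F = {u ∈ 𝒰 : u₀ ≡ u₁ ≡ u₂ (𝔭)}` (★ `mem_latticeStabilizer_latt_rhoZero_iff` at `s = 0`, `c = 1`), so the classes are the RESIDUE PAIRS `(ū, w̄) = (D₀∕D₂, D₁∕D₂) mod 𝔭` with
`(ū + Nȳ)(w̄ + Nζ̄) = NȳNζ̄`, `ū, w̄ ≠ 0`: parametrised by `A := ū + Nȳ ∈ 𝓀 ∖ {0, Nȳ}` — **`q − 2` of them**.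
* §1 `letters_of_isVertexLattice_two_latt_rhoZeroH` ∕ `isVertexLattice_two_latt_rhoZeroH_of` ∕ `…_iff` — the exact `Δ₂(latt W)`.
* §2 `exists_mem_fixedUnitStabilizer_rhoZeroH_iff` — relatedness ⟺ `D₀∕D₂ ≡ D′₀∕D′₂` and `D₁∕D₂ ≡ D′₁∕D′₂ (𝔭)`.
* FILE (H1b) `F0P3cDyRamDiagonalCoreHangingRhoZeroCountTypeTwo` then counts the classes: `polarisationCount σ ϖ 2 (latt W(y,ζ)) = q − 2`.
HONEST LABEL.  Count-neutral; the census laws stay PROVER TARGETS until the MS assembly lands; `HC_CM` is proved only modulo the 7 printed citations (2 remaining named inputs: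
hLiu418 = `stmt-HodgeConjecture-24832`, h413 = `stmt-HodgeConjecture-24833`) until rung 0 closes.

## References
* [Jacobowitz1962] R. Jacobowitz, *Hermitian forms over local fields*, Amer. J. Math. 84 (1962), §7 (modular lattices and their Gram matrices).
* [Kottwitz1986BaseChangeUnits] R. Kottwitz, *Base change for unit elements of Hecke algebras*, Compositio Math. 60 (1986), §1 pp. 240–241 (counting modulo the torus).
* [Serre1979] J.-P. Serre, *Local Fields*, GTM 67, Springer (1979), Ch. IV §2 Prop. 6 (`U∕U^{(1)} ≅ 𝓀^×`).
-/

set_option autoImplicit false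

noncomputable section

namespace Summit.HodgeConjecture.HodgeConjecture.Cruxes.H413.F0P3cDyRamDiagonalCoreHangingRhoZeroTypeTwo

open Matrix
open Literature.NumberTheory.Automorphic Literature.NumberTheory.Automorphic.HermitianLattice Literature.NumberTheory.Automorphic.UnitaryGroup
open Literature.NumberTheory.Automorphic.UnitaryLatticeTree
open Summit.HodgeConjecture.HodgeConjecture.Cruxes.H413.F0P3cDyRamDiagonalTorusDefs
open Summit.HodgeConjecture.HodgeConjecture.Cruxes.H413.F0P3cDyRamDiagonalStrataDefs
open Summit.HodgeConjecture.HodgeConjecture.Cruxes.H413.F0P3cDyRamDiagonalStableLatticeHNF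
open Summit.HodgeConjecture.HodgeConjecture.Cruxes.H413.F0P3cDyRamDiagonalGluedTubeCriterion
open Summit.HodgeConjecture.HodgeConjecture.Cruxes.H413.F0P3cDyRamDiagonalGluedTorusOrbits
open Summit.HodgeConjecture.HodgeConjecture.Cruxes.H413.F0P3cDyRamDiagonalGluedStabiliserIndex
open Summit.HodgeConjecture.HodgeConjecture.Cruxes.H413.F0P3cDyRamDiagonalGluedClassRepresentatives
open Summit.HodgeConjecture.HodgeConjecture.Cruxes.H413.F0P3cDyRamDiagonalGluedRhoZero
open Summit.HodgeConjecture.HodgeConjecture.Cruxes.H413.F0P3cDyRamDiagonalPolarisationCoset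
open Summit.HodgeConjecture.HodgeConjecture.Cruxes.H413.F0P3cDyRamDiagonalPolarisationCountTools
open Summit.HodgeConjecture.HodgeConjecture.Cruxes.H413.F0P3cDyRamDiagonalCoreHangingPolarisationsTypeTwo
open scoped Valued WithZero Matrix MatrixGroups

variable {K : Type*} [Field K] [Valued K ℤᵐ⁰]

/-! ## §1  The exact set of type-2 polarisations of `latt W(y, ζ)` -/

/-- **NECESSITY ON `H(1)`**: if `latt W(y,ζ)`, `W = (1 0 0; 0 1 0; y ζ ϖ)` with `y, ζ` units, is a type-2 vertex of the fixed non-degenerate `diag D` (ramified letters `hfix`,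
`|ϖ| = exp(−1)`), then ALL `|Dᵢ| = 1` (`|D₂| = 1` by the axis `𝔭e₃` and the entry `G₀₂ = σy·D₂·ϖ`; then `|D₀|, |D₁| ≤ 1` by `G₀₀ = D₀ + Ny·D₂`, `G₁₁ = D₁ + Nζ·D₂` and
`|D₀D₁D₂| = 1` by `|det G| = |ϖ|²`) and the `(2,2)` COFACTOR CONGRUENCE `|(D₀ + Ny·D₂)(D₁ + Nζ·D₂) − Ny·Nζ·D₂²| ≤ |ϖ|` ((A) `v_cofactor_le_of_isIntMatrix_smul_inv`).
[cite: Jacobowitz1962, §7] [cite: Kottwitz1986BaseChangeUnits, §1 pp. 240–241] -/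
theorem letters_of_isVertexLattice_two_latt_rhoZeroH {σ : K →+* K} (hvσ : ∀ a, Valued.v (σ a) = Valued.v a)
    (hfix : ∀ x : K, σ x = x → x ≠ 0 → ∃ n : ℤ, Valued.v x = WithZero.exp (2 * n)) {ϖ : K} (hϖ : Valued.v ϖ = WithZero.exp (-1 : ℤ))
    {y ζ : K} (hy : Valued.v y = 1) (hζ : Valued.v ζ = 1)
    (W : GL (Fin 3) K) (hW : (W : Matrix (Fin 3) (Fin 3) K) = !![1, 0, 0; 0, 1, 0; y, ζ, ϖ])
    {D : Fin 3 → K} (hD : ∀ i, σ (D i) = D i ∧ D i ≠ 0) (hvert : IsVertexLattice σ ϖ (Matrix.diagonal D) 2 (latt (W : Matrix (Fin 3) (Fin 3) K))) :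
    (∀ i, Valued.v (D i) = 1) ∧ Valued.v ((D 0 + σ y * y * D 2) * (D 1 + σ ζ * ζ * D 2) - σ y * y * (σ ζ * ζ) * D 2 ^ 2) ≤ Valued.v ϖ := by
  obtain ⟨hϖ0, hϖ1⟩ := ne_zero_and_v_lt_one_of_v_eq_exp hϖ
  have hvϖ : 0 < Valued.v ϖ := (Valuation.pos_iff _).2 hϖ0
  have hD2 : D 2 ≠ 0 := (hD 2).2
  have hD2pos : 0 < Valued.v (D 2) := (Valuation.pos_iff _).2 hD2
  have hdetD : IsUnit (Matrix.diagonal D).det := by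
    rw [Matrix.det_diagonal, Fin.prod_univ_three]
    exact (mul_ne_zero (mul_ne_zero (hD 0).2 (hD 1).2) hD2).isUnit
  -- the lattice is integral
  have hint : ∀ m ∈ latt (W : Matrix (Fin 3) (Fin 3) K), ∀ i, Valued.v (m i) ≤ 1 := by
    intro m hm i
    rw [hW] at hm
    have hle := latt_hnf_le_stdLattice (x := 0) (y := y) (z := ζ) (p := 1) (r := ϖ) (by rw [map_zero]; exact zero_le_one) hy.le hζ.le
      (by rw [map_one]) hϖ1.le
    exact (mem_stdLattice.1 (hle hm)) i
  -- `|D₂| ≥ 1`: `ϖ·D₂⁻¹ e₃ ∈ ϖM^♯ ⊆ M` lies on the axis `𝔭 e₃`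
  have hw' : Pi.single (2 : Fin 3) (D 2)⁻¹ ∈ dualLatt σ (Matrix.diagonal D) (latt (W : Matrix (Fin 3) (Fin 3) K)) := by
    rw [mem_dualLatt]
    intro m hm
    rw [pairing_apply]
    have hsum : ∑ i : Fin 3, ∑ j : Fin 3, σ (m i) * Matrix.diagonal D i j * (Pi.single (2 : Fin 3) (D 2)⁻¹ : Fin 3 → K) j = σ (m 2) := by
      simp [Matrix.diagonal, Pi.single_apply, hD2]
    rw [hsum, hvσ]
    exact hint m hm 2
  have hw : Pi.single (2 : Fin 3) (ϖ * (D 2)⁻¹) ∈ latt (W : Matrix (Fin 3) (Fin 3) K) := by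
    refine scaleLattice_dualLatt_le_of_isVertexLattice hvσ hdetD hvert ((mem_scaleLattice_iff hϖ0 _ _).2 ?_)
    rwa [← smul_eq_mul, Pi.single_smul', smul_smul, inv_mul_cancel₀ hϖ0, one_smul]
  have hD2ge : 1 ≤ Valued.v (D 2) := by
    rw [hW] at hw
    have h := (single_two_mem_latt_hnf_iff 0 y ζ one_ne_zero hϖ0 _).1 hw
    rw [map_mul, map_inv₀] at h
    have h' : Valued.v ϖ * (Valued.v (D 2))⁻¹ ≤ Valued.v ϖ * 1 := by rwa [mul_one]
    exact (inv_le_one₀ hD2pos).1 (le_of_mul_le_mul_left h' hvϖ)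
  have ha : (Valued.v ϖ ^ (2 * 0))⁻¹ ≤ Valued.v (D 2) := by rwa [Nat.mul_zero, pow_zero, inv_one]
  -- the Gram matrix
  obtain ⟨hG, hGinv, hGdet⟩ := (isVertexLattice_latt_iff_of_v σ hvσ hϖ0 (Matrix.diagonal D) 2 W).1 hvert
  have hGe := formCongr_hnf_diagonal σ D 0 y ζ 1 ϖ W hW
  -- `|D₂| ≤ |ϖ|⁻¹`: the entry `G₀₂ = σy·D₂·ϖ`
  have hb : Valued.v (D 2) * Valued.v ϖ ^ (2 * 0 + 1) ≤ 1 := by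
    have h02 := hG 0 2
    rw [hGe] at h02
    simp only [Matrix.of_apply, Matrix.cons_val', Matrix.cons_val_zero, Matrix.cons_val_two, Matrix.empty_val', Matrix.cons_val_fin_one, Matrix.tail_cons,
      Matrix.head_cons, Fin.isValue] at h02
    rw [map_mul, map_mul, hvσ, hy, one_mul] at h02
    rwa [Nat.mul_zero, Nat.zero_add, pow_one]
  have hvD2 : Valued.v (D 2) = 1 := by
    have h := v_eq_of_fixed_of_bounds hfix hϖ 0 (hD 2).1 hD2 ha hb
    rwa [Nat.mul_zero, pow_zero, inv_one] at h
  have hvNy : Valued.v (σ y * y) = 1 := by rw [map_mul, hvσ, hy, one_mul]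
  have hvNζ : Valued.v (σ ζ * ζ) = 1 := by rw [map_mul, hvσ, hζ, one_mul]
  -- `|D₀| ≤ 1`, `|D₁| ≤ 1` from `G₀₀`, `G₁₁`
  have hD0le : Valued.v (D 0) ≤ 1 := by
    have h00 := hG 0 0
    rw [hGe] at h00
    simp only [Matrix.of_apply, Matrix.cons_val', Matrix.cons_val_zero, Matrix.empty_val', Matrix.cons_val_fin_one, Fin.isValue, map_zero, zero_mul,
      mul_zero, add_zero] at h00
    have e : D 0 = (D 0 + σ y * D 2 * y) - σ y * D 2 * y := by ring
    rw [e]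
    refine Valuation.map_sub_le _ h00 ?_
    rw [map_mul, map_mul, hvσ, hy, hvD2, one_mul, one_mul]
  have hD1le : Valued.v (D 1) ≤ 1 := by
    have h11 := hG 1 1
    rw [hGe] at h11
    simp only [Matrix.of_apply, Matrix.cons_val', Matrix.cons_val_one, Matrix.empty_val', Matrix.cons_val_fin_one, Fin.isValue, map_one,
      one_mul, mul_one] at h11
    have e : D 1 = (D 1 + σ ζ * D 2 * ζ) - σ ζ * D 2 * ζ := by ring
    rw [e]
    refine Valuation.map_sub_le _ h11 ?_
    rw [map_mul, map_mul, hvσ, hζ, hvD2, one_mul, one_mul]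
  -- `|D₀D₁D₂| = 1` from the determinant
  have hprod : Valued.v (D 0) * Valued.v (D 1) = 1 := by
    have h := hGdet
    rw [det_formCongr_diagonal, det_coe_hnf 0 y ζ 1 ϖ W hW, one_mul, map_mul, map_mul, hvσ, map_mul, map_mul, hvD2, mul_one, sq] at h
    -- `|ϖ|·(|D₀||D₁|)·|ϖ| = |ϖ|·|ϖ|`
    have h' : Valued.v ϖ * (Valued.v (D 0) * Valued.v (D 1)) * Valued.v ϖ = Valued.v ϖ * 1 * Valued.v ϖ := by rw [h, mul_one]
    exact mul_left_cancel₀ hvϖ.ne' (mul_right_cancel₀ hvϖ.ne' h')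
  have hvD0 : Valued.v (D 0) = 1 :=
    le_antisymm hD0le (by calc (1 : ℤᵐ⁰) = Valued.v (D 0) * Valued.v (D 1) := hprod.symm
      _ ≤ Valued.v (D 0) * 1 := mul_le_mul_right hD1le _
      _ = Valued.v (D 0) := mul_one _)
  have hvD1 : Valued.v (D 1) = 1 := by rw [hvD0, one_mul] at hprod; exact hprod
  refine ⟨fun i => ?_, ?_⟩
  · fin_cases i
    · exact hvD0
    · exact hvD1
    · exact hvD2
  -- the cofactor
  have h := v_cofactor_le_of_isIntMatrix_smul_inv hϖ0 _ hGdet hGinv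
  rw [hGe] at h
  simp only [Matrix.of_apply, Matrix.cons_val', Matrix.cons_val_zero, Matrix.cons_val_one, Matrix.empty_val', Matrix.cons_val_fin_one, Fin.isValue,
    map_zero, map_one, zero_mul, mul_zero, add_zero, one_mul, mul_one, zero_add] at h
  have e : (D 0 + σ y * D 2 * y) * (D 1 + σ ζ * D 2 * ζ) - σ y * D 2 * ζ * (σ ζ * D 2 * y) =
      (D 0 + σ y * y * D 2) * (D 1 + σ ζ * ζ * D 2) - σ y * y * (σ ζ * ζ) * D 2 ^ 2 := by ring
  rwa [e] at h

/-- **SUFFICIENCY ON `H(1)`**: for `y, ζ` units and ANY `σ`-fixed UNIT vector `D` with the cofactor congruence `|(D₀ + Ny·D₂)(D₁ + Nζ·D₂) − Ny·Nζ·D₂²| ≤ |ϖ|`, `latt W(y,ζ)` is a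
type-2 vertex of `diag D`: the Gram matrix `G = (σW)ᵀ diag D W` has integral upper-left block `(D₀ + NyD₂, σy·D₂·ζ; σζ·D₂·y, D₁ + NζD₂)`, the other five entries in `𝔭`,
`|det G| = |ϖ|²`, and `ϖ·G⁻¹` is integral by (A) `isIntMatrix_smul_inv_fin_three_of_le`. [cite: Jacobowitz1962, §7] [cite: Kottwitz1986BaseChangeUnits, §1 pp. 240–241] -/
theorem isVertexLattice_two_latt_rhoZeroH_of {σ : K →+* K} (hvσ : ∀ a, Valued.v (σ a) = Valued.v a) {ϖ : K} (hϖ0 : ϖ ≠ 0) (hϖ1 : Valued.v ϖ ≤ 1)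
    {y ζ : K} (hy : Valued.v y = 1) (hζ : Valued.v ζ = 1)
    (W : GL (Fin 3) K) (hW : (W : Matrix (Fin 3) (Fin 3) K) = !![1, 0, 0; 0, 1, 0; y, ζ, ϖ])
    {D : Fin 3 → K} (hvD : ∀ i, Valued.v (D i) = 1)
    (hcof : Valued.v ((D 0 + σ y * y * D 2) * (D 1 + σ ζ * ζ * D 2) - σ y * y * (σ ζ * ζ) * D 2 ^ 2) ≤ Valued.v ϖ) :
    IsVertexLattice σ ϖ (Matrix.diagonal D) 2 (latt (W : Matrix (Fin 3) (Fin 3) K)) := by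
  have hvϖ : 0 < Valued.v ϖ := (Valuation.pos_iff _).2 hϖ0
  have hG := formCongr_hnf_diagonal σ D 0 y ζ 1 ϖ W hW
  simp only [map_zero, map_one, zero_mul, mul_zero, add_zero, one_mul, mul_one, zero_add] at hG
  have hvσy : Valued.v (σ y) = 1 := by rw [hvσ, hy]
  have hvσζ : Valued.v (σ ζ) = 1 := by rw [hvσ, hζ]
  have hvσϖ : Valued.v (σ ϖ) = Valued.v ϖ := hvσ ϖ
  -- the four bounds of the upper-left block
  have h00 : Valued.v (D 0 + σ y * D 2 * y) ≤ 1 :=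
    Valuation.map_add_le _ (hvD 0).le (by rw [map_mul, map_mul, hvσy, hvD 2, hy, one_mul, one_mul])
  have h01 : Valued.v (σ y * D 2 * ζ) ≤ 1 := by rw [map_mul, map_mul, hvσy, hvD 2, hζ, one_mul, one_mul]
  have h10 : Valued.v (σ ζ * D 2 * y) ≤ 1 := by rw [map_mul, map_mul, hvσζ, hvD 2, hy, one_mul, one_mul]
  have h11 : Valued.v (D 1 + σ ζ * D 2 * ζ) ≤ 1 :=
    Valuation.map_add_le _ (hvD 1).le (by rw [map_mul, map_mul, hvσζ, hvD 2, hζ, one_mul, one_mul])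
  -- the five entries in `𝔭`
  have h02 : Valued.v (σ y * D 2 * ϖ) ≤ Valued.v ϖ := by rw [map_mul, map_mul, hvσy, hvD 2, one_mul, one_mul]
  have h12 : Valued.v (σ ζ * D 2 * ϖ) ≤ Valued.v ϖ := by rw [map_mul, map_mul, hvσζ, hvD 2, one_mul, one_mul]
  have h20 : Valued.v (σ ϖ * D 2 * y) ≤ Valued.v ϖ := by rw [map_mul, map_mul, hvσϖ, hvD 2, hy, mul_one, mul_one]
  have h21 : Valued.v (σ ϖ * D 2 * ζ) ≤ Valued.v ϖ := by rw [map_mul, map_mul, hvσϖ, hvD 2, hζ, mul_one, mul_one]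
  have h22 : Valued.v (σ ϖ * D 2 * ϖ) ≤ Valued.v ϖ := by
    rw [map_mul, map_mul, hvσϖ, hvD 2, mul_one]; exact mul_le_of_le_one_left' hϖ1
  -- the cofactor in the Gram letters
  have hcof' : Valued.v ((D 0 + σ y * D 2 * y) * (D 1 + σ ζ * D 2 * ζ) - σ y * D 2 * ζ * (σ ζ * D 2 * y)) ≤ Valued.v ϖ := by
    have e : (D 0 + σ y * D 2 * y) * (D 1 + σ ζ * D 2 * ζ) - σ y * D 2 * ζ * (σ ζ * D 2 * y) =
        (D 0 + σ y * y * D 2) * (D 1 + σ ζ * ζ * D 2) - σ y * y * (σ ζ * ζ) * D 2 ^ 2 := by ring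
    rwa [e]
  have hGint : IsIntMatrix (formCongr σ W (Matrix.diagonal D)) := by
    rw [hG]
    exact isIntMatrix_of_fin_three h00 h01 (h02.trans hϖ1) h10 h11 (h12.trans hϖ1) (h20.trans hϖ1) (h21.trans hϖ1) (h22.trans hϖ1)
  have hdet : Valued.v (formCongr σ W (Matrix.diagonal D)).det = Valued.v ϖ ^ 2 := by
    rw [det_formCongr_diagonal, det_coe_hnf 0 y ζ 1 ϖ W hW, one_mul, map_mul, map_mul, hvσϖ, map_mul, map_mul, hvD 0, hvD 1, hvD 2, one_mul, one_mul,
      mul_one, sq]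
  have hdet' := hdet
  rw [hG] at hdet'
  have hinv : IsIntMatrix (ϖ • (formCongr σ W (Matrix.diagonal D))⁻¹) := by
    rw [hG]
    exact isIntMatrix_smul_inv_fin_three_of_le hϖ0 hϖ1 hdet' h00 h01 h10 h11 h02 h12 h20 h21 h22 hcof'
  exact (isVertexLattice_latt_iff_of_v σ hvσ hϖ0 (Matrix.diagonal D) 2 W).2 ⟨hGint, hinv, hdet⟩

/-- **THE EXACT SET `Δ₂(latt W(y,ζ))` ON `H(1)`** (ramified letters): for a `σ`-fixed non-degenerate `D`, `latt W` is a type-2 vertex of `diag D` iff all `|Dᵢ| = 1` and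
`|(D₀ + Ny·D₂)(D₁ + Nζ·D₂) − Ny·Nζ·D₂²| ≤ |ϖ|`. [cite: Jacobowitz1962, §7] [cite: Kottwitz1986BaseChangeUnits, §1 pp. 240–241] -/
theorem isVertexLattice_two_latt_rhoZeroH_iff {σ : K →+* K} (hvσ : ∀ a, Valued.v (σ a) = Valued.v a)
    (hfix : ∀ x : K, σ x = x → x ≠ 0 → ∃ n : ℤ, Valued.v x = WithZero.exp (2 * n)) {ϖ : K} (hϖ : Valued.v ϖ = WithZero.exp (-1 : ℤ))
    {y ζ : K} (hy : Valued.v y = 1) (hζ : Valued.v ζ = 1)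
    (W : GL (Fin 3) K) (hW : (W : Matrix (Fin 3) (Fin 3) K) = !![1, 0, 0; 0, 1, 0; y, ζ, ϖ])
    {D : Fin 3 → K} (hD : ∀ i, σ (D i) = D i ∧ D i ≠ 0) :
    IsVertexLattice σ ϖ (Matrix.diagonal D) 2 (latt (W : Matrix (Fin 3) (Fin 3) K)) ↔
      (∀ i, Valued.v (D i) = 1) ∧ Valued.v ((D 0 + σ y * y * D 2) * (D 1 + σ ζ * ζ * D 2) - σ y * y * (σ ζ * ζ) * D 2 ^ 2) ≤ Valued.v ϖ := by
  obtain ⟨hϖ0, hϖ1⟩ := ne_zero_and_v_lt_one_of_v_eq_exp hϖ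
  exact ⟨letters_of_isVertexLattice_two_latt_rhoZeroH hvσ hfix hϖ hy hζ W hW hD,
    fun ⟨hvD, hcof⟩ => isVertexLattice_two_latt_rhoZeroH_of hvσ hϖ0 hϖ1.le hy hζ W hW hvD hcof⟩

/-! ## §2  Relatedness: the classes are the residue pairs `(D₀∕D₂, D₁∕D₂) mod 𝔭` -/

/-- **TWO TYPE-2 POLARISATIONS OF `latt W(y,ζ)` ARE `S_F`-RELATED IFF `D₀∕D₂ ≡ D′₀∕D′₂` AND `D₁∕D₂ ≡ D′₁∕D′₂ (𝔭)`** — the stabiliser is `{u ∈ 𝒰 : |u₂ − u₁| ≤ |ϖ|, |u₂ − u₀| ≤ |ϖ|}`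
(★ `mem_latticeStabilizer_latt_rhoZero_iff` at `s = 0`, `c = 1`), and `D₀∕D₂ − D′₀∕D′₂ = (D₀∕D₂)(u₂ − u₀)∕u₂` for `u = D′∕D`. [cite: Kottwitz1986BaseChangeUnits, §1 pp. 240–241] -/
theorem exists_mem_fixedUnitStabilizer_rhoZeroH_iff {σ : K →+* K} (hvσ : ∀ a, Valued.v (σ a) = Valued.v a)
    (hfix : ∀ x : K, σ x = x → x ≠ 0 → ∃ n : ℤ, Valued.v x = WithZero.exp (2 * n)) {ϖ : K} (hϖ : Valued.v ϖ = WithZero.exp (-1 : ℤ))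
    {y ζ : K} (hy : Valued.v y = 1) (hζ : Valued.v ζ = 1)
    (W : GL (Fin 3) K) (hW : (W : Matrix (Fin 3) (Fin 3) K) = !![1, 0, 0; 0, 1, 0; y, ζ, ϖ])
    {D D' : Fin 3 → K} (hD : ∀ i, σ (D i) = D i ∧ D i ≠ 0) (hvert : IsVertexLattice σ ϖ (Matrix.diagonal D) 2 (latt (W : Matrix (Fin 3) (Fin 3) K)))
    (hD' : ∀ i, σ (D' i) = D' i ∧ D' i ≠ 0) (hvert' : IsVertexLattice σ ϖ (Matrix.diagonal D') 2 (latt (W : Matrix (Fin 3) (Fin 3) K))) :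
    (∃ u ∈ fixedUnitStabilizer σ (latt (W : Matrix (Fin 3) (Fin 3) K)), ∀ i, D' i = D i * (u i : K)) ↔
      Valued.v (D 0 / D 2 - D' 0 / D' 2) ≤ Valued.v ϖ ∧ Valued.v (D 1 / D 2 - D' 1 / D' 2) ≤ Valued.v ϖ := by
  obtain ⟨hϖ0, -⟩ := ne_zero_and_v_lt_one_of_v_eq_exp hϖ
  obtain ⟨hvD, -⟩ := letters_of_isVertexLattice_two_latt_rhoZeroH hvσ hfix hϖ hy hζ W hW hD hvert
  obtain ⟨hvD', -⟩ := letters_of_isVertexLattice_two_latt_rhoZeroH hvσ hfix hϖ hy hζ W hW hD' hvert'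
  have hDne : ∀ i, D i ≠ 0 := fun i => (hD i).2
  have hD'ne : ∀ i, D' i ≠ 0 := fun i => (hD' i).2
  have hy0 : Valued.v y = Valued.v ϖ ^ 0 := by rw [pow_zero]; exact hy
  -- the stabiliser
  have hSF : ∀ {u : Fin 3 → Kˣ}, u ∈ fixedUnitTorus σ 3 → (u ∈ fixedUnitStabilizer σ (latt (W : Matrix (Fin 3) (Fin 3) K)) ↔
      Valued.v ((u 2 : K) - u 1) ≤ Valued.v ϖ ∧ Valued.v ((u 2 : K) - u 0) ≤ Valued.v ϖ) := fun {u} hu => by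
    obtain ⟨hu1, hu2⟩ := (mem_fixedUnitTorus_iff σ u).1 hu
    have hW1 : (W : Matrix (Fin 3) (Fin 3) K) = !![1, 0, 0; 0, 1, 0; y, ζ, ϖ ^ 1] := by rw [pow_one]; exact hW
    rw [mem_fixedUnitStabilizer_iff, ← mem_latticeStabilizer_iff, mem_latticeStabilizer_latt_rhoZero_iff hϖ0 (Nat.zero_le 1) hζ hy0 W hW1 u hu1, Nat.sub_zero, pow_one]
    tauto
  -- the ratio identity
  have hratio : ∀ (j : Fin 3) {u₀ u₂ : K}, D' j = D j * u₀ → D' 2 = D 2 * u₂ → Valued.v (D j / D 2 - D' j / D' 2) = Valued.v (u₂ - u₀) := fun j {u₀ u₂} h0 h2 => by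
    have hu₂ : Valued.v u₂ = 1 := by
      have h := hvD' 2; rw [h2, map_mul, hvD 2, one_mul] at h; exact h
    have hu₂0 : u₂ ≠ 0 := fun h => by rw [h, map_zero] at hu₂; exact zero_ne_one hu₂
    have hD2 := hDne 2; have hDj := hDne j
    have e : D j / D 2 - D' j / D' 2 = (D j / D 2) * u₂⁻¹ * (u₂ - u₀) := by rw [h0, h2]; field_simp
    rw [e, map_mul, map_mul, map_div₀, hvD j, hvD 2, div_one, map_inv₀, hu₂, inv_one, one_mul, one_mul]
  constructor
  · rintro ⟨u, hu, hDu⟩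
    have hu𝒰 : u ∈ fixedUnitTorus σ 3 := (Subgroup.mem_inf.1 hu).2
    obtain ⟨hb1, hb0⟩ := (hSF hu𝒰).1 hu
    exact ⟨by rw [hratio 0 (hDu 0) (hDu 2)]; exact hb0, by rw [hratio 1 (hDu 1) (hDu 2)]; exact hb1⟩
  · rintro ⟨h0, h1⟩
    let u : Fin 3 → Kˣ := fun i => Units.mk0 (D' i / D i) (div_ne_zero (hD'ne i) (hDne i))
    have hu : ∀ i, (u i : K) = D' i / D i := fun i => rfl
    have hDu : ∀ i, D' i = D i * (u i : K) := fun i => by rw [hu, mul_div_cancel₀ _ (hDne i)]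
    have hu𝒰 : u ∈ fixedUnitTorus σ 3 := by
      refine (mem_fixedUnitTorus_iff σ u).2 ⟨fun i => ?_, fun i => ?_⟩
      · rw [hu, map_div₀, hvD i, hvD' i, div_one]
      · rw [hu, map_div₀, (hD i).1, (hD' i).1]
    refine ⟨u, (hSF hu𝒰).2 ⟨?_, ?_⟩, hDu⟩
    · rw [← hratio 1 (hDu 1) (hDu 2)]; exact h1
    · rw [← hratio 0 (hDu 0) (hDu 2)]; exact h0

end Summit.HodgeConjecture.HodgeConjecture.Cruxes.H413.F0P3cDyRamDiagonalCoreHangingRhoZeroTypeTwo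

end
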